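import Mathlib.Topology.MetricSpace.CoveringNumbers
import Mathlib.MeasureTheory.Measure.Haar.NormedSpace
import Mathlib.MeasureTheory.Measure.Lebesgue.EqHaar

/-!
# Volume bounds for packing and covering numbers

In a finite-dimensional real normed space with an additive Haar measure `μ`, an `ε`-separated
subset `C ⊆ A` satisfies the **packing bound**

`#C · μ(B(0, ε/2)) ≤ μ(⋃_{a ∈ A} B(a, ε/2))`

(the balls `B(c, ε/2)`, `c ∈ C`, are disjoint and lie in the `ε/2`-neighbourhood of `A`;
`Metric.card_mul_measure_ball_le_of_isSeparated`). Hence, when that neighbourhood has finite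
measure, the packing number of `A` is finite and a maximal `ε`-separated subset is a **finite
`ε`-net of `A` of cardinality at most the volume ratio**
(`Metric.exists_finset_cover_closedBall_card_mul_le`).

Theorems only; no named facts.

## References

* P. Mattila, *Geometry of Sets and Measures in Euclidean Spaces*, CUP 1995, §5.3 [folklore].
-/

noncomputable section

open scoped ENNReal NNReal Topology
open Set MeasureTheory Metric Filter

namespace Metric

variable {E : Type*} [NormedAddCommGroup E] [NormedSpace ℝ E] [FiniteDimensional ℝ E]
  [MeasurableSpace E] [BorelSpace E] (μ : Measure E) [μ.IsAddHaarMeasure]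

omit [NormedSpace ℝ E] [FiniteDimensional ℝ E] [MeasurableSpace E] [BorelSpace E] in
/-- `ε`-separated points are at distance `> ε`. [folklore] -/
theorem IsSeparated.lt_dist {C : Set E} {ε : ℝ≥0} (hC : IsSeparated ε C) {x y : E} (hx : x ∈ C)
    (hy : y ∈ C) (hxy : x ≠ y) : (ε : ℝ) < dist x y := by
  have h : (ε : ℝ≥0∞) < edist x y := hC hx hy hxy
  rw [edist_dist, ← ENNReal.ofReal_coe_nnreal] at h
  exact (ENNReal.ofReal_lt_ofReal_iff_of_nonneg ε.2).1 h

omit [NormedSpace ℝ E] [FiniteDimensional ℝ E] in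
/-- **Packing bound for a finite separated set**: for a finite `ε`-separated `C ⊆ A`,
`#C · μ(B(0,ε/2)) ≤ μ(⋃_{a ∈ A} B(a, ε/2))`. [folklore] -/
theorem card_mul_measure_ball_le_of_isSeparated {A : Set E} {ε : ℝ≥0} (C : Finset E)
    (hCA : (C : Set E) ⊆ A) (hC : IsSeparated ε (C : Set E)) :
    (C.card : ℝ≥0∞) * μ (ball (0 : E) (ε / 2)) ≤ μ (⋃ a ∈ A, ball a (ε / 2)) := by
  classical
  have hdisj : (C : Set E).PairwiseDisjoint fun c => ball c ((ε : ℝ) / 2) := by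
    intro x hx y hy hxy
    refine ball_disjoint_ball ?_
    have := hC.lt_dist hx hy hxy
    linarith
  have hU : μ (⋃ c ∈ C, ball c ((ε : ℝ) / 2)) = ∑ c ∈ C, μ (ball c ((ε : ℝ) / 2)) :=
    measure_biUnion_finset hdisj fun c _ => measurableSet_ball
  calc (C.card : ℝ≥0∞) * μ (ball (0 : E) (ε / 2))
      = ∑ c ∈ C, μ (ball c ((ε : ℝ) / 2)) := by
        rw [Finset.sum_congr rfl fun c _ => Measure.addHaar_ball_center μ c ((ε : ℝ) / 2),
          Finset.sum_const, nsmul_eq_mul]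
    _ = μ (⋃ c ∈ C, ball c ((ε : ℝ) / 2)) := hU.symm
    _ ≤ μ (⋃ a ∈ A, ball a (ε / 2)) := by
        refine measure_mono (iUnion₂_subset fun c hc => ?_)
        exact subset_iUnion₂_of_subset c (hCA hc) Subset.rfl

/-- **The packing number is bounded by the volume ratio**: if `0 < ε` and the
`ε/2`-neighbourhood of `A` has finite measure then every `ε`-separated `C ⊆ A` is finite with
`#C · μ(B(0,ε/2)) ≤ μ(⋃_{a ∈ A} B(a, ε/2))`, so `packingNumber ε A < ⊤`. [folklore] -/
theorem packingNumber_ne_top_of_measure_ne_top {A : Set E} {ε : ℝ≥0} (hε : 0 < ε)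
    (hA : μ (⋃ a ∈ A, ball a (ε / 2)) ≠ ⊤) : packingNumber ε A ≠ ⊤ := by
  classical
  have hb : 0 < μ (ball (0 : E) (ε / 2)) := measure_ball_pos μ 0 (by positivity)
  have hbt : μ (ball (0 : E) (ε / 2)) ≠ ⊤ := measure_ball_lt_top.ne
  -- a uniform bound `n₀` for the cardinalities of separated subsets
  obtain ⟨n₀, hn₀⟩ := ENNReal.exists_nat_gt
    (ENNReal.div_lt_top hA hb.ne').ne
  have hcard : ∀ C : Finset E, (C : Set E) ⊆ A → IsSeparated ε (C : Set E) → C.card ≤ n₀ := by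
    intro C hCA hC
    have h := card_mul_measure_ball_le_of_isSeparated μ C hCA hC
    have h2 : (C.card : ℝ≥0∞) ≤ μ (⋃ a ∈ A, ball a (ε / 2)) / μ (ball (0 : E) (ε / 2)) := by
      rw [ENNReal.le_div_iff_mul_le (Or.inl hb.ne') (Or.inl hbt)]
      exact h
    have h3 : (C.card : ℝ≥0∞) < n₀ := h2.trans_lt hn₀
    exact_mod_cast h3.le
  -- hence every separated subset is finite with `encard ≤ n₀`
  have henc : ∀ C : Set E, C ⊆ A → IsSeparated ε C → C.encard ≤ n₀ := by
    intro C hCA hC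
    by_cases hfin : C.Finite
    · have := hcard hfin.toFinset (by simpa using hCA) (by simpa using hC)
      rw [hfin.encard_eq_coe_toFinset_card]
      exact_mod_cast this
    · exfalso
      obtain ⟨C', hC'C, hC'card⟩ := Set.Infinite.exists_subset_card_eq hfin (n₀ + 1)
      have := hcard C' (hC'C.trans hCA) (IsSeparated.subset hC'C hC)
      omega
  refine ne_top_of_le_ne_top (ENat.coe_ne_top n₀) ?_
  exact iSup₂_le fun C hCA => iSup_le fun hC => henc C hCA hC

/-- **Finite nets of cardinality bounded by a volume ratio**: if `0 < ε` and the
`ε/2`-neighbourhood of `A` has finite measure, there is a finite `N ⊆ A` with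
`A ⊆ ⋃_{y ∈ N} 𝐁(y, ε)` and `#N · μ(B(0, ε/2)) ≤ μ(⋃_{a ∈ A} B(a, ε/2))`. [folklore] -/
theorem exists_finset_cover_closedBall_card_mul_le {A : Set E} {ε : ℝ≥0} (hε : 0 < ε)
    (hA : μ (⋃ a ∈ A, ball a (ε / 2)) ≠ ⊤) :
    ∃ N : Finset E, (N : Set E) ⊆ A ∧ A ⊆ ⋃ y ∈ N, closedBall y ε ∧
      (N.card : ℝ≥0∞) * μ (ball (0 : E) (ε / 2)) ≤ μ (⋃ a ∈ A, ball a (ε / 2)) := by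
  classical
  have hpack := packingNumber_ne_top_of_measure_ne_top μ hε hA
  have hfin : (maximalSeparatedSet ε A).Finite := by
    rw [← Set.encard_ne_top_iff, encard_maximalSeparatedSet hpack]
    exact hpack
  refine ⟨hfin.toFinset, by simpa using maximalSeparatedSet_subset, ?_, ?_⟩
  · have hcov := isCover_maximalSeparatedSet hpack
    rw [isCover_iff_subset_iUnion_closedBall] at hcov
    simpa using hcov
  · exact card_mul_measure_ball_le_of_isSeparated μ _ (by simpa using maximalSeparatedSet_subset)
      (by simpa using isSeparated_maximalSeparatedSet)

end Metric
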